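import Literature.NumberTheory.Sieve.PrimePowersInProgressions
import Mathlib.Analysis.SpecialFunctions.Trigonometric.Bounds
import Mathlib.Analysis.SpecialFunctions.Complex.Log
import Mathlib.Algebra.Field.GeomSum
import HarnessLib

/-!
# Two elementary sums from the proof of Titchmarsh's Lemma 9.22

Topic `Literature/NumberTheory/LFunctions`. Everything in this file is PROVED (no definitions, no
named facts).

Titchmarsh, *The Theory of the Riemann Zeta-Function*, §9.22, evaluates
`∫_T^{T+U} z₁(t)² (n/m)^{it} dt` by stationary phase; two elementary estimates enter:

* **Geometric sums with a rational phase** (§9.22: "The inner sum is therefore `ν₂ − ν₁ + O(n)`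
  if `n ∣ μ`, and `O(n)` otherwise"): for `n ≥ 1` and `n ∤ k`,
  `‖∑_{ν=a}^{b} e(−kν/n)‖ ≤ n/2` (`Literature.NumberTheory.LFunctions.TwistedMoment.norm_sum_cexp_rational_le`),
  since `|1 − e(x)| = 2|sin πx| ≥ 4/n` for `x = k/n ∉ ℤ`
  (`Literature.NumberTheory.LFunctions.TwistedMoment.norm_cexp_rational_sub_one_ge`), while for
  `n ∣ k` every term is `1` (`…cexp_rational_eq_one`).
* **The error sums of (9.22.2)** (§9.22: "`∑∑ (μν)^{-1/2} min(1/|log(2πμνm/nT)|, T^{1/2}) = …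
  = O(T^{1/2+ε})`", here without the divisor-function step and without `T^ε`): for `ν₀ ≥ 1`, `B > 0`,
  `∑_{ν ≤ P} ν^{-1/2} / max(|log(ν/ν₀)|, B⁻¹) ≤ 6 P^{1/2} + 3B ν₀^{-1/2} + 10 ν₀^{1/2} (2 + log P + log ⌈ν₀⌉)`
  (`Literature.NumberTheory.LFunctions.TwistedMoment.sum_rpow_div_max_log_le`), by
  `|log(ν/ν₀)| ≥ |ν − ν₀|/(ν + ν₀)` and a split at `|ν − ν₀| < 1`, `ν ∉ (ν₀/2, 2ν₀)`.

## References

* E. C. Titchmarsh, *The Theory of the Riemann Zeta-Function*, 2nd ed. (rev. D. R. Heath-Brown),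
  Oxford 1986, §9.22 (proof of Lemma 9.22). [cite: Titchmarsh1986, §9.22]
-/

noncomputable section

open Finset Real Complex

namespace Literature.NumberTheory.LFunctions.TwistedMoment

/-! ### Geometric sums with a rational phase -/

/-- `‖e^{ix} − 1‖ = 2|sin(x/2)|`. [folklore] -/
theorem norm_cexp_I_mul_sub_one (x : ℝ) : ‖cexp (I * x) - 1‖ = 2 * |Real.sin (x / 2)| := by
  have h1 : cexp (I * x) - 1 = ((Real.cos x - 1 : ℝ) : ℂ) + (Real.sin x : ℝ) * I := by
    rw [mul_comm, Complex.exp_mul_I, ← Complex.ofReal_cos, ← Complex.ofReal_sin]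
    push_cast; ring
  rw [h1, Complex.norm_add_mul_I]
  have h2 : (Real.cos x - 1) ^ 2 + Real.sin x ^ 2 = (2 * Real.sin (x / 2)) ^ 2 := by
    have hs := Real.sin_sq_eq_half_sub (x / 2)
    rw [show 2 * (x / 2) = x by ring] at hs
    nlinarith [Real.sin_sq_add_cos_sq x]
  rw [h2, Real.sqrt_sq_eq_abs, abs_mul, abs_two]

/-- `|sin(πk/n)| ≥ 2/n` for `n ∤ k` (Jordan's inequality at the nearest multiple of `π`). [folklore] -/
theorem abs_sin_pi_mul_div_ge {k n : ℕ} (hn : 0 < n) (hk : ¬ n ∣ k) :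
    2 / (n : ℝ) ≤ |Real.sin (π * k / n)| := by
  have hnR : (0 : ℝ) < n := by exact_mod_cast hn
  set r := k % n with hr
  have hr0 : r ≠ 0 := fun h => hk (Nat.dvd_of_mod_eq_zero h)
  have hrn : r < n := Nat.mod_lt k hn
  -- reduce to `r`
  have hper : |Real.sin (π * k / n)| = |Real.sin (π * r / n)| := by
    have hk' : (k : ℝ) = n * (k / n : ℕ) + r := by
      rw [hr]; exact_mod_cast (Nat.div_add_mod k n).symm
    rw [hk', show π * ((n : ℝ) * (k / n : ℕ) + r) / n = π * r / n + (k / n : ℕ) * π by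
      field_simp; ring]
    rw [Real.sin_add_nat_mul_pi, abs_mul, abs_pow, abs_neg, abs_one, one_pow, one_mul]
  rw [hper]
  -- the two cases `r ≤ n/2` and `r > n/2`
  rcases le_or_gt (2 * r) n with h2 | h2
  · have hx0 : 0 ≤ π * r / n := by positivity
    have hx1 : π * r / n ≤ π / 2 := by
      rw [div_le_div_iff₀ hnR two_pos]
      have : (2 : ℝ) * r ≤ n := by exact_mod_cast h2
      nlinarith [Real.pi_pos]
    have hj := Real.mul_le_sin hx0 hx1
    have hr1 : (1 : ℝ) ≤ r := by exact_mod_cast Nat.one_le_iff_ne_zero.2 hr0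
    rw [abs_of_nonneg (Real.sin_nonneg_of_nonneg_of_le_pi hx0 (by linarith [Real.pi_pos]))]
    refine le_trans ?_ hj
    rw [show 2 / π * (π * r / n) = 2 * r / n by field_simp]
    exact div_le_div_of_nonneg_right (by linarith) hnR.le
  · -- use `sin(π r/n) = sin(π (n-r)/n)`
    set r' := n - r with hr'
    have hr'pos : 0 < r' := by omega
    have h2' : 2 * r' ≤ n := by omega
    have hsin : Real.sin (π * r / n) = Real.sin (π * r' / n) := by
      have : π * (r : ℝ) / n = π - π * r' / n := by
        rw [hr', Nat.cast_sub hrn.le]; field_simp; ring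
      rw [this, Real.sin_pi_sub]
    rw [hsin]
    have hx0 : 0 ≤ π * r' / n := by positivity
    have hx1 : π * r' / n ≤ π / 2 := by
      rw [div_le_div_iff₀ hnR two_pos]
      have : (2 : ℝ) * r' ≤ n := by exact_mod_cast h2'
      nlinarith [Real.pi_pos]
    have hj := Real.mul_le_sin hx0 hx1
    have hr1 : (1 : ℝ) ≤ r' := by exact_mod_cast hr'pos
    rw [abs_of_nonneg (Real.sin_nonneg_of_nonneg_of_le_pi hx0 (by linarith [Real.pi_pos]))]
    refine le_trans ?_ hj
    rw [show 2 / π * (π * r' / n) = 2 * r' / n by field_simp]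
    exact div_le_div_of_nonneg_right (by linarith) hnR.le

/-- **`|e(−k/n) − 1| ≥ 4/n`** for `n ∤ k`. [folklore] -/
theorem norm_cexp_rational_sub_one_ge {k n : ℕ} (hn : 0 < n) (hk : ¬ n ∣ k) :
    4 / (n : ℝ) ≤ ‖cexp (-(2 * π * I * k / n)) - 1‖ := by
  have h := norm_cexp_I_mul_sub_one (-(2 * π * k / n))
  have hrw : I * ((-(2 * π * k / n) : ℝ) : ℂ) = -(2 * π * I * k / n) := by push_cast; ring
  rw [hrw] at h
  rw [h, show (-(2 * π * (k : ℝ) / n)) / 2 = -(π * k / n) by ring, Real.sin_neg, abs_neg]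
  have := abs_sin_pi_mul_div_ge hn hk
  have h4 : (4 : ℝ) / n = 2 * (2 / n) := by ring
  rw [h4]
  linarith

/-- For `n ∣ k` every term `e(−kν/n)` is `1`. [folklore] -/
theorem cexp_rational_eq_one {k n : ℕ} (hn : 0 < n) (hk : n ∣ k) (ν : ℕ) :
    cexp (-(2 * π * I * k / n) * ν) = 1 := by
  obtain ⟨q, rfl⟩ := hk
  have hnC : (n : ℂ) ≠ 0 := by exact_mod_cast hn.ne'
  have h1 : (2 * π * I * ((n * q : ℕ) : ℂ) / n) = 2 * π * I * q := by
    push_cast; field_simp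
  have : -(2 * π * I * ((n * q : ℕ) : ℂ) / n) * ν = ((-(q * ν : ℕ) : ℤ) : ℂ) * (2 * π * I) := by
    rw [h1]; push_cast; ring
  rw [this, Complex.exp_int_mul_two_pi_mul_I]

/-- **Geometric sums with a rational phase** (Titchmarsh §9.22: "`O(n)` otherwise"): for `n ∤ k`,
`‖∑_{a ≤ ν ≤ b} e(−kν/n)‖ ≤ n/2`. [cite: Titchmarsh1986, §9.22] -/
theorem norm_sum_cexp_rational_le {k n : ℕ} (hn : 0 < n) (hk : ¬ n ∣ k) (a b : ℕ) :
    ‖∑ ν ∈ Finset.Icc a b, cexp (-(2 * π * I * k / n) * ν)‖ ≤ (n : ℝ) / 2 := by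
  set w : ℂ := cexp (-(2 * π * I * k / n)) with hw
  have hterm : ∀ ν : ℕ, cexp (-(2 * π * I * k / n) * ν) = w ^ ν := by
    intro ν; rw [hw, ← Complex.exp_nat_mul]; ring_nf
  have hw1 : w ≠ 1 := by
    intro h
    have := norm_cexp_rational_sub_one_ge hn hk
    rw [← hw, h, sub_self, norm_zero] at this
    have : (0 : ℝ) < 4 / n := by positivity
    linarith
  have hwn : ‖w‖ = 1 := by
    rw [hw, show -(2 * π * I * (k : ℂ) / n) = ((-(2 * π * k / n) : ℝ) : ℂ) * I by push_cast; ring,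
      Complex.norm_exp_ofReal_mul_I]
  simp_rw [hterm]
  rcases lt_or_ge b a with hab | hab
  · rw [Finset.Icc_eq_empty (by omega), Finset.sum_empty, norm_zero]; positivity
  rw [← Finset.Ico_add_one_right_eq_Icc, geom_sum_Ico hw1 (by omega), norm_div]
  have hnum : ‖w ^ (b + 1) - w ^ a‖ ≤ 2 := by
    calc ‖w ^ (b + 1) - w ^ a‖ ≤ ‖w ^ (b + 1)‖ + ‖w ^ a‖ := norm_sub_le _ _
      _ = 2 := by rw [norm_pow, norm_pow, hwn, one_pow, one_pow]; norm_num
  have hden : 4 / (n : ℝ) ≤ ‖w - 1‖ := norm_cexp_rational_sub_one_ge hn hk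
  have hden0 : 0 < ‖w - 1‖ := lt_of_lt_of_le (by positivity) hden
  rw [div_le_iff₀ hden0]
  have hnR : (0 : ℝ) < n := by exact_mod_cast hn
  calc ‖w ^ (b + 1) - w ^ a‖ ≤ 2 := hnum
    _ = (n : ℝ) / 2 * (4 / n) := by field_simp; ring
    _ ≤ (n : ℝ) / 2 * ‖w - 1‖ := mul_le_mul_of_nonneg_left hden (by positivity)

/-! ### The error sums of (9.22.2) -/

/-- `∑_{ν=1}^{P} ν^{-1/2} ≤ 2 P^{1/2}` (`ν^{-1/2} ≤ 2(√ν − √(ν−1))`). [folklore] -/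
theorem sum_Icc_rpow_neg_half_le (P : ℕ) :
    ∑ ν ∈ Finset.Icc 1 P, (ν : ℝ) ^ (-(1 / 2 : ℝ)) ≤ 2 * Real.sqrt P := by
  induction P with
  | zero => simp
  | succ P ih =>
    rw [Finset.sum_Icc_succ_top (by omega), Nat.cast_succ]
    have hP0 : (0 : ℝ) ≤ P := Nat.cast_nonneg P
    have hP1 : (0 : ℝ) < P + 1 := by linarith
    have hs1 : Real.sqrt (P + 1) ^ 2 = P + 1 := Real.sq_sqrt hP1.le
    have hs0 : Real.sqrt P ^ 2 = P := Real.sq_sqrt hP0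
    have hsp : 0 < Real.sqrt (P + 1) := Real.sqrt_pos.2 hP1
    have hterm : ((P : ℝ) + 1) ^ (-(1 / 2 : ℝ)) = (Real.sqrt (P + 1))⁻¹ := by
      rw [Real.rpow_neg hP1.le, ← Real.sqrt_eq_rpow]
    rw [hterm]
    -- `1/√(P+1) ≤ 2(√(P+1) − √P)`
    have hkey : (Real.sqrt (P + 1))⁻¹ ≤ 2 * (Real.sqrt (P + 1) - Real.sqrt P) := by
      rw [inv_le_iff_one_le_mul₀ hsp]
      have hle : Real.sqrt P ≤ Real.sqrt (P + 1) := Real.sqrt_le_sqrt (by linarith)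
      nlinarith [Real.sqrt_nonneg (P : ℝ), hs1, hs0]
    linarith

/-- `|log(ν/ν₀)| ≥ |ν − ν₀|/(ν + ν₀)` for `ν, ν₀ > 0`. [folklore] -/
theorem abs_sub_div_add_le_abs_log_div {ν ν₀ : ℝ} (hν : 0 < ν) (hν₀ : 0 < ν₀) :
    |ν - ν₀| / (ν + ν₀) ≤ |Real.log (ν / ν₀)| := by
  have hsum : 0 < ν + ν₀ := by linarith
  rcases le_or_gt ν₀ ν with h | h
  · -- `log(ν/ν₀) ≥ 1 − ν₀/ν = (ν−ν₀)/ν ≥ (ν−ν₀)/(ν+ν₀)`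
    have h1 : 1 - ν₀ / ν ≤ Real.log (ν / ν₀) := by
      have := Real.one_sub_inv_le_log_of_pos (div_pos hν hν₀)
      rwa [inv_div] at this
    rw [abs_of_nonneg (by linarith : 0 ≤ ν - ν₀), abs_of_nonneg (Real.log_nonneg ((one_le_div hν₀).2 h))]
    refine le_trans ?_ h1
    rw [div_le_iff₀ hsum]
    have : (1 - ν₀ / ν) * (ν + ν₀) = (ν - ν₀) * (ν + ν₀) / ν := by field_simp
    rw [this, le_div_iff₀ hν]
    nlinarith
  · have h1 : 1 - ν / ν₀ ≤ Real.log (ν₀ / ν) := by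
      have := Real.one_sub_inv_le_log_of_pos (div_pos hν₀ hν)
      rwa [inv_div] at this
    have hlog : Real.log (ν / ν₀) = -Real.log (ν₀ / ν) := by
      rw [← Real.log_inv, inv_div]
    rw [abs_of_neg (by linarith : ν - ν₀ < 0), hlog, abs_neg,
      abs_of_nonneg (Real.log_nonneg ((one_le_div hν).2 h.le))]
    refine le_trans ?_ h1
    rw [div_le_iff₀ hsum]
    have : (1 - ν / ν₀) * (ν + ν₀) = (ν₀ - ν) * (ν + ν₀) / ν₀ := by field_simp
    rw [this, le_div_iff₀ hν₀]
    nlinarith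

/-- The pointwise bound for the summands of the error sums: for `1 ≤ ν`, `1 ≤ ν₀`, `B > 0`,
`ν^{-1/2}/max(|log(ν/ν₀)|, B⁻¹)` is `≤ 3 ν^{-1/2}` if `ν ∉ (ν₀/2, 2ν₀)`, `≤ 3B ν₀^{-1/2}/2` if
`|ν − ν₀| < 1`, and `≤ 5 ν₀^{1/2}/|ν − ν₀|` if `ν ∈ (ν₀/2, 2ν₀)`, `|ν − ν₀| ≥ 1`. [folklore] -/
theorem rpow_div_max_log_le {ν ν₀ B : ℝ} (hν : 1 ≤ ν) (hν₀ : 1 ≤ ν₀) (hB : 0 < B) :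
    ν ^ (-(1 / 2 : ℝ)) / max |Real.log (ν / ν₀)| B⁻¹ ≤
      (if ν ≤ ν₀ / 2 ∨ 2 * ν₀ ≤ ν then 3 * ν ^ (-(1 / 2 : ℝ)) else 0)
      + (if |ν - ν₀| < 1 then 3 * B / (2 * Real.sqrt ν₀) else 0)
      + (if ν₀ / 2 < ν ∧ ν < 2 * ν₀ ∧ 1 ≤ |ν - ν₀| then 5 * Real.sqrt ν₀ / |ν - ν₀| else 0) := by
  have hν0 : 0 < ν := by linarith
  have hν₀0 : 0 < ν₀ := by linarith
  have hm : 0 < max |Real.log (ν / ν₀)| B⁻¹ := lt_max_of_lt_right (inv_pos.2 hB)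
  have hpow : ν ^ (-(1 / 2 : ℝ)) = (Real.sqrt ν)⁻¹ := by
    rw [Real.rpow_neg hν0.le, ← Real.sqrt_eq_rpow]
  have hpow0 : 0 < ν ^ (-(1 / 2 : ℝ)) := Real.rpow_pos_of_pos hν0 _
  have hsν : 0 < Real.sqrt ν := Real.sqrt_pos.2 hν0
  have hsν₀ : 0 < Real.sqrt ν₀ := Real.sqrt_pos.2 hν₀0
  -- nonnegativity of the three pieces
  have hA0 : 0 ≤ (if ν ≤ ν₀ / 2 ∨ 2 * ν₀ ≤ ν then 3 * ν ^ (-(1 / 2 : ℝ)) else 0) := by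
    split_ifs <;> positivity
  have hB0 : 0 ≤ (if |ν - ν₀| < 1 then 3 * B / (2 * Real.sqrt ν₀) else 0) := by
    split_ifs <;> positivity
  have hC0 : 0 ≤ (if ν₀ / 2 < ν ∧ ν < 2 * ν₀ ∧ 1 ≤ |ν - ν₀| then 5 * Real.sqrt ν₀ / |ν - ν₀| else 0) := by
    split_ifs <;> positivity
  by_cases hfar : ν ≤ ν₀ / 2 ∨ 2 * ν₀ ≤ ν
  · -- far: `1/max ≤ 1/|log| ≤ (ν+ν₀)/|ν−ν₀| ≤ 3`
    rw [if_pos hfar]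
    have hne : 0 < |ν - ν₀| := by
      rcases hfar with h | h <;> [rw [abs_of_neg (by linarith)]; rw [abs_of_nonneg (by linarith)]] <;> linarith
    have hlog := abs_sub_div_add_le_abs_log_div hν0 hν₀0
    have h3 : |ν - ν₀| / (ν + ν₀) ≥ 1 / 3 := by
      rw [ge_iff_le, div_le_div_iff₀ (by norm_num) (by linarith)]
      rcases hfar with h | h
      · rw [abs_of_neg (by linarith)]; linarith
      · rw [abs_of_nonneg (by linarith)]; linarith
    have hmax : 1 / 3 ≤ max |Real.log (ν / ν₀)| B⁻¹ := le_max_of_le_left (h3.le.trans hlog |>.trans' le_rfl)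
    calc ν ^ (-(1 / 2 : ℝ)) / max |Real.log (ν / ν₀)| B⁻¹ ≤ ν ^ (-(1 / 2 : ℝ)) / (1 / 3) :=
          div_le_div_of_nonneg_left hpow0.le (by norm_num) hmax
      _ = 3 * ν ^ (-(1 / 2 : ℝ)) := by ring
      _ ≤ _ := by linarith
  · rw [if_neg hfar, zero_add]
    push Not at hfar
    obtain ⟨h1, h2⟩ := hfar
    -- middle: `ν^{-1/2} ≤ √(2/ν₀) ≤ 3/(2√ν₀)`
    have hνhalf : ν₀ / 2 < ν := h1
    have hsqrt : ν ^ (-(1 / 2 : ℝ)) ≤ 3 / (2 * Real.sqrt ν₀) := by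
      rw [hpow]
      have hle : 2 * Real.sqrt ν₀ / 3 ≤ Real.sqrt ν := by
        refine Real.le_sqrt_of_sq_le ?_
        have : (2 * Real.sqrt ν₀ / 3) ^ 2 = 4 * ν₀ / 9 := by
          rw [div_pow, mul_pow, Real.sq_sqrt hν₀0.le]; ring
        rw [this]; linarith
      calc (Real.sqrt ν)⁻¹ ≤ (2 * Real.sqrt ν₀ / 3)⁻¹ := by gcongr
        _ = 3 / (2 * Real.sqrt ν₀) := by rw [inv_div]
    by_cases hnear : |ν - ν₀| < 1
    · rw [if_pos hnear, if_neg (fun h => absurd h.2.2 (not_le.2 hnear))]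
      rw [add_zero]
      have hmax : B⁻¹ ≤ max |Real.log (ν / ν₀)| B⁻¹ := le_max_right _ _
      calc ν ^ (-(1 / 2 : ℝ)) / max |Real.log (ν / ν₀)| B⁻¹ ≤ ν ^ (-(1 / 2 : ℝ)) / B⁻¹ :=
            div_le_div_of_nonneg_left hpow0.le (inv_pos.2 hB) hmax
        _ = ν ^ (-(1 / 2 : ℝ)) * B := by rw [div_inv_eq_mul]
        _ ≤ 3 / (2 * Real.sqrt ν₀) * B := mul_le_mul_of_nonneg_right hsqrt hB.le
        _ = 3 * B / (2 * Real.sqrt ν₀) := by ring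
    · push Not at hnear
      rw [if_neg (not_lt.2 hnear), if_pos ⟨h1, h2, hnear⟩, zero_add]
      have hne : 0 < |ν - ν₀| := lt_of_lt_of_le one_pos hnear
      have hlog := abs_sub_div_add_le_abs_log_div hν0 hν₀0
      have hq : 0 < |ν - ν₀| / (ν + ν₀) := by positivity
      have hmax : |ν - ν₀| / (ν + ν₀) ≤ max |Real.log (ν / ν₀)| B⁻¹ := le_max_of_le_left hlog
      calc ν ^ (-(1 / 2 : ℝ)) / max |Real.log (ν / ν₀)| B⁻¹
          ≤ ν ^ (-(1 / 2 : ℝ)) / (|ν - ν₀| / (ν + ν₀)) := div_le_div_of_nonneg_left hpow0.le hq hmax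
        _ = ν ^ (-(1 / 2 : ℝ)) * (ν + ν₀) / |ν - ν₀| := by rw [div_div_eq_mul_div]
        _ ≤ 3 / (2 * Real.sqrt ν₀) * (3 * ν₀) / |ν - ν₀| := by
            refine div_le_div_of_nonneg_right ?_ hne.le
            exact mul_le_mul hsqrt (by linarith) (by linarith) (by positivity)
        _ = 9 / 2 * (ν₀ / Real.sqrt ν₀) / |ν - ν₀| := by ring
        _ = 9 / 2 * Real.sqrt ν₀ / |ν - ν₀| := by rw [Real.div_sqrt]
        _ ≤ 5 * Real.sqrt ν₀ / |ν - ν₀| := by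
            refine div_le_div_of_nonneg_right ?_ hne.le
            nlinarith

/-- The one-sided harmonic sums of the middle region: for integers `ν` with `ν₀ < ν ≤ P` and
`ν − ν₀ ≥ 1`, `∑ 1/(ν − ν₀) ≤ 2(1 + log P)`, and for `ν < ν₀`, `∑ 1/(ν₀ − ν) ≤ 2(1 + log ⌈ν₀⌉)`. [folklore] -/
theorem sum_filter_one_div_sub_le (P : ℕ) {ν₀ : ℝ} (hν₀ : 1 ≤ ν₀) :
    ∑ ν ∈ (Finset.Icc 1 P).filter (fun ν : ℕ => 1 ≤ (ν : ℝ) - ν₀), 1 / ((ν : ℝ) - ν₀)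
      ≤ 2 * (1 + Real.log P) ∧
    ∑ ν ∈ (Finset.Icc 1 P).filter (fun ν : ℕ => 1 ≤ ν₀ - (ν : ℝ)), 1 / (ν₀ - (ν : ℝ))
      ≤ 2 * (1 + Real.log ⌈ν₀⌉₊) := by
  have hharm : ∑ k ∈ Finset.Icc 1 P, (1 : ℝ) / k ≤ 1 + Real.log P :=
    Literature.NumberTheory.Sieve.sum_Icc_one_div_le_one_add_log P
  have hharm' : ∑ k ∈ Finset.Icc 1 ⌈ν₀⌉₊, (1 : ℝ) / k ≤ 1 + Real.log ⌈ν₀⌉₊ :=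
    Literature.NumberTheory.Sieve.sum_Icc_one_div_le_one_add_log ⌈ν₀⌉₊
  have hfl : (⌊ν₀⌋₊ : ℝ) ≤ ν₀ := Nat.floor_le (by linarith)
  have hfl1 : ν₀ < (⌊ν₀⌋₊ : ℝ) + 1 := Nat.lt_floor_add_one ν₀
  constructor
  · -- `ν ↦ k = ν − ⌊ν₀⌋`, `ν − ν₀ > k − 1`, so `1/(ν − ν₀) ≤ 2/k`
    set S := (Finset.Icc 1 P).filter (fun ν : ℕ => 1 ≤ (ν : ℝ) - ν₀) with hS
    have hmemS : ∀ ν ∈ S, ⌊ν₀⌋₊ + 1 ≤ ν ∧ ν ≤ P := by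
      intro ν hν
      rw [hS, Finset.mem_filter, Finset.mem_Icc] at hν
      refine ⟨?_, hν.1.2⟩
      have : (⌊ν₀⌋₊ : ℝ) + 1 ≤ ν := by linarith [hν.2]
      exact_mod_cast this
    have hinj : Set.InjOn (fun ν : ℕ => ν - ⌊ν₀⌋₊) S := by
      intro a ha b hb hab
      have := hmemS a ha; have := hmemS b hb
      simp only at hab; omega
    have hbound : ∀ ν ∈ S, 1 / ((ν : ℝ) - ν₀) ≤ 2 / (((ν - ⌊ν₀⌋₊ : ℕ) : ℕ) : ℝ) := by
      intro ν hν
      have hν1 : 1 ≤ (ν : ℝ) - ν₀ := (Finset.mem_filter.1 hν).2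
      obtain ⟨hk, -⟩ := hmemS ν hν
      have hkR : ((ν - ⌊ν₀⌋₊ : ℕ) : ℝ) = (ν : ℝ) - ⌊ν₀⌋₊ := by
        rw [Nat.cast_sub (by omega)]
      rw [hkR, div_le_div_iff₀ (by linarith) (by linarith)]
      nlinarith
    calc ∑ ν ∈ S, 1 / ((ν : ℝ) - ν₀) ≤ ∑ ν ∈ S, 2 / (((ν - ⌊ν₀⌋₊ : ℕ) : ℕ) : ℝ) := Finset.sum_le_sum hbound
      _ = ∑ k ∈ S.image (fun ν : ℕ => ν - ⌊ν₀⌋₊), 2 / (k : ℝ) := by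
          rw [Finset.sum_image hinj]
      _ ≤ ∑ k ∈ Finset.Icc 1 P, 2 / (k : ℝ) := by
          refine Finset.sum_le_sum_of_subset_of_nonneg (fun k hk => ?_) fun _ _ _ => by positivity
          rw [Finset.mem_image] at hk
          obtain ⟨ν, hν, rfl⟩ := hk
          have := hmemS ν hν
          rw [Finset.mem_Icc]; omega
      _ = 2 * ∑ k ∈ Finset.Icc 1 P, (1 : ℝ) / k := by
          rw [Finset.mul_sum]; exact Finset.sum_congr rfl fun k _ => by ring
      _ ≤ 2 * (1 + Real.log P) := by linarith
  · set S := (Finset.Icc 1 P).filter (fun ν : ℕ => 1 ≤ ν₀ - (ν : ℝ)) with hS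
    have hmemS : ∀ ν ∈ S, 1 ≤ ν ∧ ν + 1 ≤ ⌈ν₀⌉₊ ∧ ν ≤ P := by
      intro ν hν
      rw [hS, Finset.mem_filter, Finset.mem_Icc] at hν
      refine ⟨hν.1.1, ?_, hν.1.2⟩
      have h1 : (ν : ℝ) + 1 ≤ ν₀ := by linarith [hν.2]
      have h2 : ν₀ ≤ ⌈ν₀⌉₊ := Nat.le_ceil ν₀
      exact_mod_cast h1.trans h2
    have hceil : (⌈ν₀⌉₊ : ℝ) < ν₀ + 1 := Nat.ceil_lt_add_one (by linarith)
    have hinj : Set.InjOn (fun ν : ℕ => ⌈ν₀⌉₊ - ν) S := by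
      intro a ha b hb hab
      have := hmemS a ha; have := hmemS b hb
      simp only at hab; omega
    have hbound : ∀ ν ∈ S, 1 / (ν₀ - (ν : ℝ)) ≤ 2 / (((⌈ν₀⌉₊ - ν : ℕ) : ℕ) : ℝ) := by
      intro ν hν
      have hν1 : 1 ≤ ν₀ - (ν : ℝ) := (Finset.mem_filter.1 hν).2
      obtain ⟨-, hk, -⟩ := hmemS ν hν
      have hkR : ((⌈ν₀⌉₊ - ν : ℕ) : ℝ) = (⌈ν₀⌉₊ : ℝ) - ν := by
        rw [Nat.cast_sub (by omega)]
      have hk1 : (1 : ℝ) ≤ (⌈ν₀⌉₊ : ℝ) - ν := by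
        have : ((ν + 1 : ℕ) : ℝ) ≤ ⌈ν₀⌉₊ := by exact_mod_cast hk
        push_cast at this; linarith
      rw [hkR, div_le_div_iff₀ (by linarith) (by linarith)]
      nlinarith
    calc ∑ ν ∈ S, 1 / (ν₀ - (ν : ℝ)) ≤ ∑ ν ∈ S, 2 / (((⌈ν₀⌉₊ - ν : ℕ) : ℕ) : ℝ) := Finset.sum_le_sum hbound
      _ = ∑ k ∈ S.image (fun ν : ℕ => ⌈ν₀⌉₊ - ν), 2 / (k : ℝ) := by
          rw [Finset.sum_image hinj]
      _ ≤ ∑ k ∈ Finset.Icc 1 ⌈ν₀⌉₊, 2 / (k : ℝ) := by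
          refine Finset.sum_le_sum_of_subset_of_nonneg (fun k hk => ?_) fun _ _ _ => by positivity
          rw [Finset.mem_image] at hk
          obtain ⟨ν, hν, rfl⟩ := hk
          obtain ⟨h1, h2, h3⟩ := hmemS ν hν
          rw [Finset.mem_Icc]
          omega
      _ = 2 * ∑ k ∈ Finset.Icc 1 ⌈ν₀⌉₊, (1 : ℝ) / k := by
          rw [Finset.mul_sum]; exact Finset.sum_congr rfl fun k _ => by ring
      _ ≤ 2 * (1 + Real.log ⌈ν₀⌉₊) := by linarith

/-- **The error sums of (9.22.2).** For `ν₀ ≥ 1`, `B > 0` and `P`: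
`∑_{ν=1}^{P} ν^{-1/2}/max(|log(ν/ν₀)|, B⁻¹) ≤ 6 P^{1/2} + 3B ν₀^{-1/2} + 10 ν₀^{1/2} (2 + log P + log ⌈ν₀⌉)`
(Titchmarsh §9.22: the terms with `ν ∉ (ν₀/2, 2ν₀)` give `O(P^{1/2})`, those with `|ν − ν₀| < 1`
give `O(B ν₀^{-1/2})`, and the rest `O(ν₀^{1/2} log)`). [cite: Titchmarsh1986, §9.22] -/
theorem sum_rpow_div_max_log_le (P : ℕ) {ν₀ B : ℝ} (hν₀ : 1 ≤ ν₀) (hB : 0 < B) :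
    ∑ ν ∈ Finset.Icc 1 P, (ν : ℝ) ^ (-(1 / 2 : ℝ)) / max |Real.log (ν / ν₀)| B⁻¹ ≤
      6 * Real.sqrt P + 3 * B / Real.sqrt ν₀
        + 10 * Real.sqrt ν₀ * (2 + Real.log P + Real.log ⌈ν₀⌉₊) := by
  have hν₀0 : 0 < ν₀ := by linarith
  have hsν₀ : 0 < Real.sqrt ν₀ := Real.sqrt_pos.2 hν₀0
  -- pointwise split
  have hpt : ∀ ν ∈ Finset.Icc 1 P, (ν : ℝ) ^ (-(1 / 2 : ℝ)) / max |Real.log (ν / ν₀)| B⁻¹ ≤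
      (if (ν : ℝ) ≤ ν₀ / 2 ∨ 2 * ν₀ ≤ ν then 3 * (ν : ℝ) ^ (-(1 / 2 : ℝ)) else 0)
      + (if |(ν : ℝ) - ν₀| < 1 then 3 * B / (2 * Real.sqrt ν₀) else 0)
      + (if ν₀ / 2 < (ν : ℝ) ∧ (ν : ℝ) < 2 * ν₀ ∧ 1 ≤ |(ν : ℝ) - ν₀| then 5 * Real.sqrt ν₀ / |(ν : ℝ) - ν₀| else 0) :=
    fun ν hν => rpow_div_max_log_le (by exact_mod_cast (Finset.mem_Icc.1 hν).1) hν₀ hB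
  refine (Finset.sum_le_sum hpt).trans ?_
  rw [Finset.sum_add_distrib, Finset.sum_add_distrib]
  -- (A) far terms
  have hA : ∑ ν ∈ Finset.Icc 1 P, (if (ν : ℝ) ≤ ν₀ / 2 ∨ 2 * ν₀ ≤ ν then 3 * (ν : ℝ) ^ (-(1 / 2 : ℝ)) else 0)
      ≤ 6 * Real.sqrt P := by
    calc ∑ ν ∈ Finset.Icc 1 P, (if (ν : ℝ) ≤ ν₀ / 2 ∨ 2 * ν₀ ≤ ν then 3 * (ν : ℝ) ^ (-(1 / 2 : ℝ)) else 0)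
        ≤ ∑ ν ∈ Finset.Icc 1 P, 3 * (ν : ℝ) ^ (-(1 / 2 : ℝ)) := by
          refine Finset.sum_le_sum fun ν _ => ?_
          split_ifs
          · exact le_rfl
          · positivity
      _ = 3 * ∑ ν ∈ Finset.Icc 1 P, (ν : ℝ) ^ (-(1 / 2 : ℝ)) := by rw [Finset.mul_sum]
      _ ≤ 3 * (2 * Real.sqrt P) := by
          refine mul_le_mul_of_nonneg_left (sum_Icc_rpow_neg_half_le P) (by norm_num)
      _ = 6 * Real.sqrt P := by ring
  -- (B) near terms: at most two `ν` with `|ν − ν₀| < 1`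
  have hB' : ∑ ν ∈ Finset.Icc 1 P, (if |(ν : ℝ) - ν₀| < 1 then 3 * B / (2 * Real.sqrt ν₀) else 0)
      ≤ 3 * B / Real.sqrt ν₀ := by
    rw [← Finset.sum_filter]
    have hsub : (Finset.Icc 1 P).filter (fun ν : ℕ => |(ν : ℝ) - ν₀| < 1) ⊆
        Finset.Icc ⌊ν₀⌋₊ (⌊ν₀⌋₊ + 1) := by
      intro ν hν
      rw [Finset.mem_filter] at hν
      have h := abs_lt.1 hν.2
      have hfl : (⌊ν₀⌋₊ : ℝ) ≤ ν₀ := Nat.floor_le hν₀0.le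
      have hfl1 : ν₀ < (⌊ν₀⌋₊ : ℝ) + 1 := Nat.lt_floor_add_one ν₀
      rw [Finset.mem_Icc]
      constructor
      · have : (⌊ν₀⌋₊ : ℝ) < ν + 1 := by linarith
        exact_mod_cast Nat.lt_succ_iff.1 (by exact_mod_cast this : ⌊ν₀⌋₊ < ν + 1)
      · have : (ν : ℝ) < ⌊ν₀⌋₊ + 1 + 1 := by linarith
        have : ν < ⌊ν₀⌋₊ + 1 + 1 := by exact_mod_cast this
        omega
    have hcard : ((Finset.Icc 1 P).filter (fun ν : ℕ => |(ν : ℝ) - ν₀| < 1)).card ≤ 2 :=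
      (Finset.card_le_card hsub).trans (by rw [Nat.card_Icc]; omega)
    calc ∑ ν ∈ (Finset.Icc 1 P).filter (fun ν : ℕ => |(ν : ℝ) - ν₀| < 1), 3 * B / (2 * Real.sqrt ν₀)
        = ((Finset.Icc 1 P).filter (fun ν : ℕ => |(ν : ℝ) - ν₀| < 1)).card • (3 * B / (2 * Real.sqrt ν₀)) :=
          Finset.sum_const _
      _ ≤ 2 • (3 * B / (2 * Real.sqrt ν₀)) := by
          rw [nsmul_eq_mul, nsmul_eq_mul]
          exact mul_le_mul_of_nonneg_right (by exact_mod_cast hcard) (by positivity)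
      _ = 3 * B / Real.sqrt ν₀ := by rw [nsmul_eq_mul]; field_simp; ring
  -- (C) middle terms
  have hC : ∑ ν ∈ Finset.Icc 1 P, (if ν₀ / 2 < (ν : ℝ) ∧ (ν : ℝ) < 2 * ν₀ ∧ 1 ≤ |(ν : ℝ) - ν₀|
        then 5 * Real.sqrt ν₀ / |(ν : ℝ) - ν₀| else 0)
      ≤ 10 * Real.sqrt ν₀ * (2 + Real.log P + Real.log ⌈ν₀⌉₊) := by
    obtain ⟨hup, hdown⟩ := sum_filter_one_div_sub_le P hν₀
    have hpt2 : ∀ ν ∈ Finset.Icc 1 P, (if ν₀ / 2 < (ν : ℝ) ∧ (ν : ℝ) < 2 * ν₀ ∧ 1 ≤ |(ν : ℝ) - ν₀|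
          then 5 * Real.sqrt ν₀ / |(ν : ℝ) - ν₀| else 0) ≤
        5 * Real.sqrt ν₀ * ((if 1 ≤ (ν : ℝ) - ν₀ then 1 / ((ν : ℝ) - ν₀) else 0)
          + (if 1 ≤ ν₀ - (ν : ℝ) then 1 / (ν₀ - (ν : ℝ)) else 0)) := by
      intro ν _
      have hn1 : 0 ≤ (if 1 ≤ (ν : ℝ) - ν₀ then 1 / ((ν : ℝ) - ν₀) else 0) := by
        split_ifs with h
        · have : 0 < (ν : ℝ) - ν₀ := by linarith
          positivity
        · exact le_rfl
      have hn2 : 0 ≤ (if 1 ≤ ν₀ - (ν : ℝ) then 1 / (ν₀ - (ν : ℝ)) else 0) := by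
        split_ifs with h
        · have : 0 < ν₀ - (ν : ℝ) := by linarith
          positivity
        · exact le_rfl
      by_cases hmid : ν₀ / 2 < (ν : ℝ) ∧ (ν : ℝ) < 2 * ν₀ ∧ 1 ≤ |(ν : ℝ) - ν₀|
      · rw [if_pos hmid]
        obtain ⟨-, -, habs⟩ := hmid
        rcases le_or_gt 0 ((ν : ℝ) - ν₀) with hsgn | hsgn
        · have ha1 : 1 ≤ (ν : ℝ) - ν₀ := by rwa [abs_of_nonneg hsgn] at habs
          have hnot : ¬ (1 ≤ ν₀ - (ν : ℝ)) := by linarith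
          rw [abs_of_nonneg hsgn, if_pos ha1, if_neg hnot, add_zero, mul_one_div]
        · have ha1 : 1 ≤ ν₀ - (ν : ℝ) := by rw [abs_of_neg hsgn] at habs; linarith
          have hnot : ¬ (1 ≤ (ν : ℝ) - ν₀) := by linarith
          rw [abs_of_neg hsgn, if_neg hnot, if_pos ha1, zero_add, neg_sub, mul_one_div]
      · rw [if_neg hmid]
        exact mul_nonneg (by positivity) (add_nonneg hn1 hn2)
    refine (Finset.sum_le_sum hpt2).trans ?_
    rw [← Finset.mul_sum, Finset.sum_add_distrib, ← Finset.sum_filter, ← Finset.sum_filter]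
    have hlog0 : 0 ≤ Real.log (P : ℝ) := Real.log_natCast_nonneg P
    have hlog1 : 0 ≤ Real.log (⌈ν₀⌉₊ : ℝ) := Real.log_natCast_nonneg _
    calc 5 * Real.sqrt ν₀ * (∑ ν ∈ (Finset.Icc 1 P).filter (fun ν : ℕ => 1 ≤ (ν : ℝ) - ν₀), 1 / ((ν : ℝ) - ν₀)
          + ∑ ν ∈ (Finset.Icc 1 P).filter (fun ν : ℕ => 1 ≤ ν₀ - (ν : ℝ)), 1 / (ν₀ - (ν : ℝ)))
        ≤ 5 * Real.sqrt ν₀ * (2 * (1 + Real.log P) + 2 * (1 + Real.log ⌈ν₀⌉₊)) :=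
          mul_le_mul_of_nonneg_left (add_le_add hup hdown) (by positivity)
      _ = 10 * Real.sqrt ν₀ * (2 + Real.log P + Real.log ⌈ν₀⌉₊) := by ring
  linarith

end Literature.NumberTheory.LFunctions.TwistedMoment
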